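import Summits.AtomisticToContinuum.Crystallization.Theorems.ExcessDecayLiouvillePhononStabilityCertTable

/-!
# Near-certificate layer II: parametric Gram data

Support file for crux `PhononStability` (line `contragredient-window-collapse`): parametric (monomial-weighted) Gram data over a stencil of label slots, its evaluation on a label field as a sum of PSD local forms, and the exact expansion of that evaluation into two-point tables (diagonal and cross blocks by polarisation). [folklore]
-/

noncomputable section

open scoped BigOperators Classical InnerProductSpace
open Filter Set Function
open Summit.AtomisticToContinuum.Crystallization.Theorems.PhononStabilityNegative

namespace Summit.AtomisticToContinuum.Crystallization.Theorems.PhononStabilityCWC.Cert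

local notation "E3" => EuclideanSpace ℝ (Fin 3)

/-! ## Parametric Gram data -/

/-- A parametric Gram datum: base sublattice, slots `(m'_i, n_i)`, number of basis monomials, factor rows
(flattened coefficients indexed by `(monomial a, slot i, component c) ↦ a·(3S) + 3i + c`). -/
structure GramP where
  /-- base sublattice -/
  base : Fin 2
  /-- slots -/
  slots : List (Fin 2 × (Fin 3 → ℤ))
  /-- number of basis monomials -/
  nmono : ℕ
  /-- factor rows (dense, flattened index `a·(3S) + 3i + c`; arrays for constant-time access) -/
  rows : Array (Array ℚ)
  /-- nonnegative row weights (missing entries mean weight 1) -/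
  weights : Array ℚ := #[]

namespace GramP

variable (G : GramP)

/-- number of slots -/
def S : ℕ := G.slots.length
/-- number of rows -/
def R : ℕ := G.rows.size
/-- slot accessor -/
def slot (i : Fin G.S) : Fin 2 × (Fin 3 → ℤ) := G.slots.getD i.val (0, 0)
/-- factor accessor `V r a i c` -/
def V (r : Fin G.R) (a : Fin G.nmono) (i : Fin G.S) (c : Fin 3) : ℚ :=
  (G.rows.getD r.val #[]).getD (a.val * (3 * G.S) + 3 * i.val + c.val) 0
/-- row weight `c_r` (default 1) -/
def cw (r : Fin G.R) : ℚ := G.weights.getD r.val 1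
/-- all row weights are nonnegative -/
def weightsOK : Bool := (List.finRange G.R).all fun r => decide (0 ≤ G.cw r)
/-- rational pair block `B^{ab}_{ij}(c,d) = Σ_r c_r V_{r,a,i,c} V_{r,b,j,d}` -/
def blockPair (a b : Fin G.nmono) (i j : Fin G.S) : Mat := fun c d => ∑ r : Fin G.R, G.cw r * G.V r a i c * G.V r b j d
/-- difference vector at slot `i`, base point `k` -/
def D (w : Label → E3) (k : Fin 3 → ℤ) (i : Fin G.S) : Fin 3 → ℝ :=
  cov w ((G.slot i).1, k + (G.slot i).2) - cov w (G.base, k)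
/-- evaluated factor `W_{r,i,c}(μ) = Σ_a μ_a V_{r,a,i,c}` for monomial values `μ` -/
def W (μ : Fin G.nmono → ℝ) (r : Fin G.R) (i : Fin G.S) (c : Fin 3) : ℝ := ∑ a : Fin G.nmono, μ a * (G.V r a i c : ℝ)
/-- value of factor row `r` -/
def rowVal (μ : Fin G.nmono → ℝ) (w : Label → E3) (k : Fin 3 → ℤ) (r : Fin G.R) : ℝ :=
  ∑ i : Fin G.S, ∑ c : Fin 3, G.W μ r i c * G.D w k i c
/-- local Gram form `Σ_r c_r (row_r(μ) · D_k)²` -/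
def localForm (μ : Fin G.nmono → ℝ) (w : Label → E3) (k : Fin 3 → ℤ) : ℝ :=
  ∑ r : Fin G.R, (G.cw r : ℝ) * (G.rowVal μ w k r) ^ 2
/-- the Gram form -/
def eval (μ : Fin G.nmono → ℝ) (w : Label → E3) : ℝ := ∑' k, G.localForm μ w k

/-- weights are nonnegative when `weightsOK`. [folklore] -/
theorem cw_nonneg (h : G.weightsOK = true) (r : Fin G.R) : 0 ≤ G.cw r := by
  unfold weightsOK at h
  rw [List.all_eq_true] at h
  simpa using h r (List.mem_finRange r)

/-- each local form is a nonnegative combination of squares. [folklore] -/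
theorem localForm_nonneg (h : G.weightsOK = true) (μ : Fin G.nmono → ℝ) (w : Label → E3) (k : Fin 3 → ℤ) :
    0 ≤ G.localForm μ w k :=
  Finset.sum_nonneg fun r _ => mul_nonneg (by exact_mod_cast G.cw_nonneg h r) (sq_nonneg _)

/-- **The parametric Gram form is nonnegative** (for every value of the monomials). -/
theorem eval_nonneg (h : G.weightsOK = true) (μ : Fin G.nmono → ℝ) (w : Label → E3) : 0 ≤ G.eval μ w :=
  tsum_nonneg (G.localForm_nonneg h μ w)

/-- Expansion into pair blocks: `Σ_r (row·D)² = Σ_{a,b} μ_a μ_b Σ_{i,j} bil B^{ab}_{ij} D_i D_j`. -/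
theorem localForm_eq (μ : Fin G.nmono → ℝ) (w : Label → E3) (k : Fin 3 → ℤ) :
    G.localForm μ w k = ∑ a : Fin G.nmono, ∑ b : Fin G.nmono, μ a * μ b *
      ∑ i : Fin G.S, ∑ j : Fin G.S, bil (G.blockPair a b i j) (G.D w k i) (G.D w k j) := by
  -- both sides = Σ over (r, i, j, c, d, a, b) of μa μb V V D D
  have lhs : G.localForm μ w k = ∑ r : Fin G.R, ∑ i : Fin G.S, ∑ j : Fin G.S, ∑ c : Fin 3, ∑ d : Fin 3,
      ∑ a : Fin G.nmono, ∑ b : Fin G.nmono,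
        μ a * μ b * ((G.cw r : ℝ) * G.V r a i c * G.V r b j d * G.D w k i c * G.D w k j d) := by
    unfold localForm rowVal
    refine Finset.sum_congr rfl fun r _ => ?_
    rw [sq, Finset.sum_mul_sum, Finset.mul_sum]
    refine Finset.sum_congr rfl fun i _ => ?_
    rw [Finset.mul_sum]
    refine Finset.sum_congr rfl fun j _ => ?_
    rw [Finset.sum_mul_sum, Finset.mul_sum]
    refine Finset.sum_congr rfl fun c _ => ?_
    rw [Finset.mul_sum]
    refine Finset.sum_congr rfl fun d _ => ?_
    unfold W
    rw [Finset.sum_mul, Finset.sum_mul, Finset.sum_mul, Finset.mul_sum]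
    refine Finset.sum_congr rfl fun a _ => ?_
    rw [Finset.mul_sum, Finset.mul_sum]
    refine Finset.sum_congr rfl fun b _ => ?_
    ring
  have rhs : (∑ a : Fin G.nmono, ∑ b : Fin G.nmono, μ a * μ b *
      ∑ i : Fin G.S, ∑ j : Fin G.S, bil (G.blockPair a b i j) (G.D w k i) (G.D w k j)) =
      ∑ a : Fin G.nmono, ∑ b : Fin G.nmono, ∑ i : Fin G.S, ∑ j : Fin G.S, ∑ c : Fin 3, ∑ d : Fin 3, ∑ r : Fin G.R,
        μ a * μ b * ((G.cw r : ℝ) * G.V r a i c * G.V r b j d * G.D w k i c * G.D w k j d) := by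
    refine Finset.sum_congr rfl fun a _ => Finset.sum_congr rfl fun b _ => ?_
    rw [Finset.mul_sum]
    refine Finset.sum_congr rfl fun i _ => ?_
    rw [Finset.mul_sum]
    refine Finset.sum_congr rfl fun j _ => ?_
    unfold bil blockPair
    rw [Finset.mul_sum]
    refine Finset.sum_congr rfl fun c _ => ?_
    rw [Finset.mul_sum]
    refine Finset.sum_congr rfl fun d _ => ?_
    rw [Rat.cast_sum, Finset.sum_mul, Finset.sum_mul, Finset.mul_sum]
    refine Finset.sum_congr rfl fun r _ => ?_
    push_cast; ring
  rw [lhs, rhs]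
  -- reorder (r, (i, j, c, d), (a, b)) → ((a, b), (i, j, c, d), r) through product types
  have E : ∀ g : Fin G.R → (Fin G.S × Fin G.S × Fin 3 × Fin 3) → (Fin G.nmono × Fin G.nmono) → ℝ,
      (∑ r, ∑ p, ∑ q, g r p q) = ∑ q, ∑ p, ∑ r, g r p q := by
    intro g
    calc (∑ r, ∑ p, ∑ q, g r p q) = ∑ p, ∑ r, ∑ q, g r p q := Finset.sum_comm
      _ = ∑ p, ∑ q, ∑ r, g r p q := Finset.sum_congr rfl fun p _ => Finset.sum_comm
      _ = ∑ q, ∑ p, ∑ r, g r p q := Finset.sum_comm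
  have := E (fun r p q => μ q.1 * μ q.2 *
    ((G.cw r : ℝ) * G.V r q.1 p.1 p.2.2.1 * G.V r q.2 p.2.1 p.2.2.2 * G.D w k p.1 p.2.2.1 * G.D w k p.2.1 p.2.2.2))
  simpa [Fintype.sum_prod_type] using this

/-- The four two-point entries of a cross term `Σ'_k bil Q (D_i k) (D_j k)`. -/
def crossTable (Q : Mat) (i j : Fin G.S) : TPTable :=
  let si := G.slot i
  let sj := G.slot j
  [((si.1, sj.1, sj.2 - si.2), Q), ((si.1, G.base, -si.2), fun a b => -Q a b),
    ((G.base, sj.1, sj.2), fun a b => -Q a b), ((G.base, G.base, 0), Q)]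

/-- the zero test of a rational matrix -/
def matIsZero (Q : Mat) : Bool :=
  decide (Q 0 0 = 0 ∧ Q 0 1 = 0 ∧ Q 0 2 = 0 ∧ Q 1 0 = 0 ∧ Q 1 1 = 0 ∧ Q 1 2 = 0 ∧ Q 2 0 = 0 ∧ Q 2 1 = 0 ∧ Q 2 2 = 0)

/-- a matrix passing the zero test is zero. [folklore] -/
theorem eq_zero_of_matIsZero {Q : Mat} (h : matIsZero Q = true) : Q = fun _ _ => 0 := by
  unfold matIsZero at h
  rw [decide_eq_true_eq] at h
  obtain ⟨h00, h01, h02, h10, h11, h12, h20, h21, h22⟩ := h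
  funext i j
  fin_cases i <;> fin_cases j <;> assumption

/-- does basis monomial `a` touch slot `i` in any factor row? -/
def nzFlag (a : Fin G.nmono) (i : Fin G.S) : Bool :=
  (List.finRange G.R).any fun r => (List.finRange 3).any fun c => !decide (G.V r a i c = 0)

/-- the table of the flags (computed once per Gram datum and passed to `table`) -/
def nzTab : Array (Array Bool) := Array.ofFn fun a : Fin G.nmono => Array.ofFn fun i : Fin G.S => G.nzFlag a i

/-- flag lookup (default `true` = no pruning claim) -/
def nzGet (nz : Array (Array Bool)) (a : Fin G.nmono) (i : Fin G.S) : Bool := (nz.getD a.val #[]).getD i.val true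

/-- the lookup in the genuine flag table is the flag. [folklore] -/
theorem nzGet_nzTab (a : Fin G.nmono) (i : Fin G.S) : G.nzGet G.nzTab a i = G.nzFlag a i := by
  simp [nzGet, nzTab, Array.getD_eq_getD_getElem?]

/-- a cleared flag means the whole `(a, i)` block of every row vanishes, hence every pair block with it. [folklore] -/
theorem blockPair_eq_zero_of_flag {a : Fin G.nmono} {i : Fin G.S} (h : G.nzFlag a i = false) (b : Fin G.nmono)
    (j : Fin G.S) : (G.blockPair a b i j = fun _ _ => 0) ∧ (G.blockPair b a j i = fun _ _ => 0) := by
  have hz : ∀ r c, G.V r a i c = 0 := by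
    intro r c
    unfold nzFlag at h
    rw [List.any_eq_false] at h
    have h1 := h r (List.mem_finRange r)
    rw [Bool.not_eq_true, List.any_eq_false] at h1
    have h2 := h1 c (List.mem_finRange c)
    simpa using h2
  constructor <;> funext c d <;> simp [blockPair, hz]

/-- The two-point table attached to the monomial pair `(a, b)` (structurally empty blocks skipped by the flags,
zero blocks pruned, blocks materialised). -/
def table (nz : Array (Array Bool)) (a b : Fin G.nmono) : TPTable :=
  (List.finRange G.S).flatMap fun i => (List.finRange G.S).flatMap fun j =>
    if G.nzGet nz a i && G.nzGet nz b j then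
      let Q := mat9 (G.blockPair a b i j)
      if matIsZero Q then [] else G.crossTable Q i j
    else []

/-- expansion of `bil M (x − z) (y − z)`. [folklore] -/
theorem bil_sub_sub' (M : Mat) (x y z : Fin 3 → ℝ) :
    bil M (x - z) (y - z) = bil M x y - bil M x z - bil M z y + bil M z z := by
  simp only [bil, Pi.sub_apply]
  have : ∀ i j, (M i j : ℝ) * (x i - z i) * (y j - z j) =
      (M i j : ℝ) * x i * y j - (M i j : ℝ) * x i * z j - (M i j : ℝ) * z i * y j + (M i j : ℝ) * z i * z j := by
    intro i j; ring
  simp only [this, Finset.sum_add_distrib, Finset.sum_sub_distrib]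

/-- two-slot entries are summable on finitely supported fields. [folklore] -/
theorem summable_entry₂ {w : Label → E3} (hw : (support w).Finite) (M : Mat) (m₁ : Fin 2) (n₁ : Fin 3 → ℤ)
    (m₂ : Fin 2) (n₂ : Fin 3 → ℤ) :
    Summable (fun k : Fin 3 → ℤ => bil M (cov w (m₁, k + n₁)) (cov w (m₂, k + n₂))) := by
  refine summable_of_hasFiniteSupport ?_
  have hw' : w.HasFiniteSupport := hw
  have h1 : (fun k : Fin 3 → ℤ => w (m₁, k + n₁)).HasFiniteSupport :=
    hw'.fun_comp_of_injective (g := fun k : Fin 3 → ℤ => ((m₁, k + n₁) : Label)) fun k k' h => by simpa using h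
  refine h1.subset fun k hk => ?_
  simp only [Function.mem_support, ne_eq] at hk ⊢
  intro h0; apply hk; simp [cov_eq_zero_of h0, bil]

/-- Cross terms are two-point tables. -/
theorem cross_eq {w : Label → E3} (hw : (support w).Finite) (Q : Mat) (i j : Fin G.S) :
    ∑' k, bil Q (G.D w k i) (G.D w k j) = tpEval (G.crossTable Q i j) w := by
  set si := G.slot i
  set sj := G.slot j
  simp only [crossTable, tpEval_cons, tpEval_nil, add_zero, tpEntry, D, bil_sub_sub', bil_neg]
  have s1 : Summable fun k : Fin 3 → ℤ => bil Q (cov w (si.1, k + si.2)) (cov w (sj.1, k + sj.2)) :=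
    summable_entry₂ hw Q si.1 si.2 sj.1 sj.2
  have s2 : Summable fun k : Fin 3 → ℤ => bil Q (cov w (si.1, k + si.2)) (cov w (G.base, k)) := by
    simpa using summable_entry₂ hw Q si.1 si.2 G.base 0
  have s3 : Summable fun k : Fin 3 → ℤ => bil Q (cov w (G.base, k)) (cov w (sj.1, k + sj.2)) := by
    simpa using summable_entry₂ hw Q G.base 0 sj.1 sj.2
  have s4 : Summable fun k : Fin 3 → ℤ => bil Q (cov w (G.base, k)) (cov w (G.base, k)) := by
    simpa using summable_entry₂ hw Q G.base 0 G.base 0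
  rw [((s1.sub s2).sub s3).tsum_add s4, (s1.sub s2).tsum_sub s3, s1.tsum_sub s2]
  have e1 : ∑' k : Fin 3 → ℤ, bil Q (cov w (si.1, k + si.2)) (cov w (sj.1, k + sj.2)) =
      ∑' k : Fin 3 → ℤ, bil Q (cov w (si.1, k)) (cov w (sj.1, k + (sj.2 - si.2))) := by
    rw [← (Equiv.addRight si.2).tsum_eq (fun k => bil Q (cov w (si.1, k)) (cov w (sj.1, k + (sj.2 - si.2))))]
    refine tsum_congr fun k => ?_
    simp only [Equiv.coe_addRight]
    have h : k + si.2 + (sj.2 - si.2) = k + sj.2 := by abel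
    rw [h]
  have e2 : ∑' k : Fin 3 → ℤ, bil Q (cov w (si.1, k + si.2)) (cov w (G.base, k)) =
      ∑' k : Fin 3 → ℤ, bil Q (cov w (si.1, k)) (cov w (G.base, k + -si.2)) := by
    rw [← (Equiv.addRight si.2).tsum_eq (fun k => bil Q (cov w (si.1, k)) (cov w (G.base, k + -si.2)))]
    refine tsum_congr fun k => ?_
    simp only [Equiv.coe_addRight]
    have h : k + si.2 + -si.2 = k := by abel
    rw [h]
  rw [e1, e2, tsum_neg, tsum_neg]
  ring

/-- evaluation of a flat-mapped table. [folklore] -/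
theorem tpEval_flatMap {ι : Type*} (l : List ι) (f : ι → TPTable) (w : Label → E3) :
    tpEval (l.flatMap f) w = (l.map fun i => tpEval (f i) w).sum := by
  induction l with
  | nil => rfl
  | cons a rest ih => simp [List.flatMap_cons, tpEval_append, ih]

/-- cross blocks are summable on finitely supported fields. [folklore] -/
theorem summable_cross {w : Label → E3} (hw : (support w).Finite) (Q : Mat) (i j : Fin G.S) :
    Summable fun k : Fin 3 → ℤ => bil Q (G.D w k i) (G.D w k j) := by
  refine summable_of_hasFiniteSupport ?_
  have hw' : w.HasFiniteSupport := hw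
  have hb : (fun k : Fin 3 → ℤ => w (G.base, k)).HasFiniteSupport :=
    hw'.fun_comp_of_injective (g := fun k : Fin 3 → ℤ => ((G.base, k) : Label)) (Prod.mk_right_injective _)
  have hi : (fun k : Fin 3 → ℤ => w ((G.slot i).1, k + (G.slot i).2)).HasFiniteSupport :=
    hw'.fun_comp_of_injective (g := fun k : Fin 3 → ℤ => (((G.slot i).1, k + (G.slot i).2) : Label))
      fun k k' h => by simpa using h
  refine (hb.union hi).subset fun k hk => ?_
  simp only [Function.mem_support, ne_eq, Set.mem_union] at hk ⊢
  by_contra h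
  push Not at h
  apply hk
  have : G.D w k i = 0 := by
    unfold D; rw [cov_eq_zero_of h.2, cov_eq_zero_of h.1, sub_zero]
  simp [this, bil]

/-- **The parametric Gram form is the μ-weighted sum of its rational two-point tables.** -/
theorem eval_eq_table {w : Label → E3} (hw : (support w).Finite) (μ : Fin G.nmono → ℝ) :
    G.eval μ w = ∑ a : Fin G.nmono, ∑ b : Fin G.nmono, μ a * μ b * tpEval (G.table G.nzTab a b) w := by
  unfold eval
  simp only [G.localForm_eq]
  have hs : ∀ a b : Fin G.nmono, Summable fun k : Fin 3 → ℤ =>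
      μ a * μ b * ∑ i : Fin G.S, ∑ j : Fin G.S, bil (G.blockPair a b i j) (G.D w k i) (G.D w k j) :=
    fun a b => (summable_sum fun i _ => summable_sum fun j _ => G.summable_cross hw _ i j).mul_left _
  rw [Summable.tsum_finsetSum (fun a _ => summable_sum fun b _ => hs a b)]
  refine Finset.sum_congr rfl fun a _ => ?_
  rw [Summable.tsum_finsetSum (fun b _ => hs a b)]
  refine Finset.sum_congr rfl fun b _ => ?_
  rw [tsum_mul_left]
  congr 1
  unfold table
  rw [Summable.tsum_finsetSum (fun i _ => summable_sum fun j _ => G.summable_cross hw _ i j),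
    tpEval_flatMap, ← List.ofFn_eq_map, List.sum_ofFn]
  refine Finset.sum_congr rfl fun i _ => ?_
  rw [Summable.tsum_finsetSum (fun j _ => G.summable_cross hw _ i j), tpEval_flatMap, ← List.ofFn_eq_map, List.sum_ofFn]
  refine Finset.sum_congr rfl fun j _ => ?_
  simp only [mat9_eq]
  split_ifs with hg hz
  · rw [eq_zero_of_matIsZero hz]
    simp [bil, tpEval]
  · exact G.cross_eq hw _ i j
  · -- a cleared flag: the block vanishes
    rw [Bool.and_eq_true, not_and_or] at hg
    simp only [Bool.not_eq_true, nzGet_nzTab] at hg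
    have h0 : G.blockPair a b i j = fun _ _ => 0 := by
      rcases hg with hg | hg
      · exact (G.blockPair_eq_zero_of_flag hg b j).1
      · exact (G.blockPair_eq_zero_of_flag hg a i).2
    rw [h0]
    simp [bil, tpEval]

end GramP

/-! ## Real-matrix pair forms (the bridge to the line's forms) -/

/-- real bilinear form -/
def bilR (M : Fin 3 → Fin 3 → ℝ) (x y : Fin 3 → ℝ) : ℝ := ∑ i, ∑ j, M i j * x i * y j

/-- real pair form in covariant coordinates -/
def pairEvalR (c : BondClass) (M : Fin 3 → Fin 3 → ℝ) (w : Label → E3) : ℝ := ∑' k, bilR M (covDiff c w k) (covDiff c w k)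

/-- rational and real bilinear forms agree. [folklore] -/
theorem bil_eq_bilR (M : Mat) (x y : Fin 3 → ℝ) : bil M x y = bilR (fun i j => (M i j : ℝ)) x y := rfl

/-- rational and real pair forms agree. [folklore] -/
theorem pairEval_eq_pairEvalR (c : BondClass) (M : Mat) (w : Label → E3) :
    pairEval c M w = pairEvalR c (fun i j => (M i j : ℝ)) w := rfl

/-- additivity of `bilR` in the matrix. [folklore] -/
theorem bilR_add (M N : Fin 3 → Fin 3 → ℝ) (x y : Fin 3 → ℝ) :
    bilR (fun i j => M i j + N i j) x y = bilR M x y + bilR N x y := by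
  simp only [bilR, add_mul, Finset.sum_add_distrib]

/-- homogeneity of `bilR` in the matrix. [folklore] -/
theorem bilR_smul (c : ℝ) (M : Fin 3 → Fin 3 → ℝ) (x y : Fin 3 → ℝ) :
    bilR (fun i j => c * M i j) x y = c * bilR M x y := by
  simp only [bilR, Finset.mul_sum]
  refine Finset.sum_congr rfl fun i _ => Finset.sum_congr rfl fun j _ => ?_
  ring

/-- `bilR (z zᵀ) x x = (z · x)²` -/
theorem bilR_outer (z x : Fin 3 → ℝ) : bilR (fun i j => z i * z j) x x = (∑ i, z i * x i) ^ 2 := by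
  simp only [bilR, sq, Finset.sum_mul_sum]
  refine Finset.sum_congr rfl fun i _ => Finset.sum_congr rfl fun j _ => ?_
  ring

/-- pair forms with an outer-product matrix are nonnegative -/
theorem pairEvalR_outer_nonneg (c : BondClass) (z : Fin 3 → ℝ) (w : Label → E3) :
    0 ≤ pairEvalR c (fun i j => z i * z j) w :=
  tsum_nonneg fun k => by rw [bilR_outer]; exact sq_nonneg _

/-- `k ↦ bilR M Δ̃ Δ̃` is finitely supported for finitely supported `w` -/
theorem summable_pairR {w : Label → E3} (hw : (support w).Finite) (c : BondClass) (M : Fin 3 → Fin 3 → ℝ) :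
    Summable fun k : Fin 3 → ℤ => bilR M (covDiff c w k) (covDiff c w k) := by
  refine summable_of_hasFiniteSupport ?_
  have hw' : w.HasFiniteSupport := hw
  obtain ⟨m, m', n⟩ := c
  have h1 : (fun k : Fin 3 → ℤ => w (m', k + n)).HasFiniteSupport :=
    hw'.fun_comp_of_injective (g := fun k : Fin 3 → ℤ => ((m', k + n) : Label)) fun k k' h => by simpa using h
  have h2 : (fun k : Fin 3 → ℤ => w (m, k)).HasFiniteSupport :=
    hw'.fun_comp_of_injective (g := fun k : Fin 3 → ℤ => ((m, k) : Label)) (Prod.mk_right_injective _)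
  refine (h1.union h2).subset fun k hk => ?_
  simp only [Function.mem_support, ne_eq, Set.mem_union] at hk ⊢
  by_contra h
  push Not at h
  apply hk
  have : covDiff (m, m', n) w k = 0 := by
    unfold covDiff bondDiff
    simp only [h.1, h.2, sub_zero, covOf_zero]
  simp [this, bilR]

/-- additivity of the real pair form in the matrix. [folklore] -/
theorem pairEvalR_add {w : Label → E3} (hw : (support w).Finite) (c : BondClass) (M N : Fin 3 → Fin 3 → ℝ) :
    pairEvalR c (fun i j => M i j + N i j) w = pairEvalR c M w + pairEvalR c N w := by
  unfold pairEvalR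
  simp only [bilR_add]
  exact (summable_pairR hw c M).tsum_add (summable_pairR hw c N)

/-- homogeneity of the real pair form in the matrix. [folklore] -/
theorem pairEvalR_smul (c : BondClass) (a : ℝ) (M : Fin 3 → Fin 3 → ℝ) (w : Label → E3) :
    pairEvalR c (fun i j => a * M i j) w = a * pairEvalR c M w := by
  unfold pairEvalR
  simp only [bilR_smul]
  exact tsum_mul_left

/-- monotonicity in a PSD-type direction: if `pairEvalR c K w ≥ 0` then scaling by a larger coefficient gives more -/
theorem mul_pairEvalR_mono {a b : ℝ} (hab : a ≤ b) {c : BondClass} {K : Fin 3 → Fin 3 → ℝ} {w : Label → E3}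
    (hK : 0 ≤ pairEvalR c K w) : a * pairEvalR c K w ≤ b * pairEvalR c K w :=
  mul_le_mul_of_nonneg_right hab hK

/-- Anchor of this support file (registered stub of the line skeleton). -/
theorem stub_certGram : ∀ G : GramP, G.weightsOK = true →
    ∀ (μ : Fin G.nmono → ℝ) (w : Label → EuclideanSpace ℝ (Fin 3)), 0 ≤ G.eval μ w :=
  fun G h μ w => G.eval_nonneg h μ w

end Summit.AtomisticToContinuum.Crystallization.Theorems.PhononStabilityCWC.Cert

end
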